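import Summits.AtomisticToContinuum.Crystallization.Theorems.FrustratedLawDichotomyDeletedAtoms
import Literature.Probability.Process.PointStationaryTransfer

/-!
# FrustratedLawDichotomy · crux `AperiodicFrustratedLawGap` (stmt-AtomisticToContinuum-27623) — MINIMISING LAWS HAVE NO RATTLERS
# (decomp-a2c, prover hand 2, structural share, generation 2)

First application of THINNING STABILITY (`FrustratedLawDichotomyThinning.thinning_stability`): delete the `R`-ISOLATED atoms (those with no
other atom within distance `R`), i.e. thin by `G_R = {ν | 1 < ν(B̄(0,R))}`.  At a kept root the deletion raises the root energy by at most
`(1/12) Σ_{y isolated} ‖y‖⁻⁶`; by MASS TRANSPORT (Mecke) `E_P[1_{G} Σ_{y isolated} ‖y‖⁻⁶] ≤ E_P[1_{Gᶜ} Σ_{y ≠ 0} ‖y‖⁻⁶]`, and at an isolated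
root `Σ_{y≠0} ‖y‖⁻⁶ ≤ 250 δ⁻³ R⁻³` (two-scale shell bound) while `rootEnergy ≥ −(1/12) Σ ‖y‖⁻⁶`.  For a minimiser this gives
`P(Gᶜ)·|e⋆| ≤ P(Gᶜ)·(250/6) δ⁻³ R⁻³`, so with `e⋆ ≤ −1/24`:

* `ae_crowded_of_minimising` — **NO RATTLERS**: granted the floor of item 9229, a point-stationary `δ`-hard-core probability law with
  `E_P[rootEnergy] ≤ e⋆` has, for every `R ≥ 1` with `10 < δ R`, almost surely ANOTHER ATOM WITHIN DISTANCE `R` OF THE ROOT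
  (`1 < μ(B̄(0,R))`), and — everything shows at the root (Aldous–Lyons transfer) — `ae_forall_crowded_of_minimising`: almost surely
  EVERY atom has another atom within distance `R`.  (With the tree's sharper `e⋆ ≤ −0.711` the threshold becomes `δ R > 3.9`.)

All `[folklore]`.
-/

noncomputable section

namespace Summit.AtomisticToContinuum.Crystallization.Theorems.FrustratedLawDichotomyThinning

open MeasureTheory Metric Set Filter ProbabilityTheory
open scoped ENNReal Topology BigOperators
open Literature.MathematicalPhysics.StatisticalMechanics Literature.Probability.Process
open Literature.Probability.Process.LocalConfig (finite_inter_of_separated)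
open Summit.AtomisticToContinuum.Crystallization.Theorems.ChargedEnergyGapNegative
  (E3 eStar eStar_le_groundStateEnergy_div dimer dimer_injective interactionEnergy_dimer)
open Summit.AtomisticToContinuum.Crystallization.Theorems.BenjaminiSchrammLimit (measurableSet_setOf_isRootedHardCore)
open Summit.AtomisticToContinuum.Crystallization.Theorems.FrustratedLawDichotomyFiniteClusterGap
  (ae_mem_of_sep exists_kernel_eq_count_restrict measurable_kernel_map_sub integrable_rootEnergy_of_ae_hardCore)
open Summit.AtomisticToContinuum.Crystallization.Theorems.FrustratedLawDichotomyVirial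
  (measurable_ofReal_invPow integrable_invPow rootEnergy_eq_moments lintegral_invPow_le_of_isRootedHardCore)

section NoRattlers

variable {δ R : ℝ} {P : Measure (Measure E3)}

/-! ### No rattlers -/

/-- **MINIMISING LAWS HAVE NO RATTLERS.**  Granted the energy floor for point-stationary hard-core probability laws (item 9229, hypothesis
`hU`), every point-stationary `δ`-hard-core probability law with `E_P[rootEnergy] ≤ e⋆` has, for every radius `R ≥ δ` with `δ R > 10`,
almost surely another atom within distance `R` of the root: `1 < μ(B̄(0, R))`.  Proof: delete the `R`-isolated atoms
(`thinning_stability`), book-keep the kept roots' loss (`rootEnergy_restrict_le`, `lintegral_deleted_le`) and the deleted roots' energy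
(`neg_moment_le_rootEnergy`, `lintegral_invPow_six_le_two_scale`): `P(isolated)·|e⋆| ≤ P(isolated)·(250/6) δ⁻³R⁻³ < P(isolated)/24`.
[folklore] -/
theorem ae_crowded_of_minimising
    (hU : ∀ δ' : ℝ, 0 < δ' → ∀ Q : Measure (Measure E3), IsProbabilityMeasure Q → (∀ᵐ μ ∂Q, IsRootedHardCore δ' μ) →
      IsPointStationaryLaw Q → eStar ≤ ∫ μ, rootEnergy lennardJones μ ∂Q)
    (hδ : 0 < δ) [IsProbabilityMeasure P] (hcore : ∀ᵐ μ ∂P, IsRootedHardCore δ μ) (hstat : IsPointStationaryLaw P)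
    (hmin : ∫ μ, rootEnergy lennardJones μ ∂P ≤ eStar) (hδR : δ ≤ R) (hR : 10 < δ * R) :
    ∀ᵐ μ ∂P, 1 < μ (closedBall (0 : E3) R) := by
  set G : Set (Measure E3) := {ν : Measure E3 | 1 < ν (closedBall (0 : E3) R)} with hGdef
  have hG : MeasurableSet G := measurableSet_crowded R
  -- it suffices that the isolated-root event is null
  suffices hnull : P Gᶜ = 0 by
    filter_upwards [measure_eq_zero_iff_ae_notMem.1 hnull] with μ hμ
    simpa [hGdef] using hμ
  by_contra hp
  have hR0 : 0 < R := hδ.trans_le hδR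
  set B : ℝ := 250 * δ⁻¹ ^ 3 * R⁻¹ ^ 3 with hB
  have hB0 : 0 ≤ B := by positivity
  -- numerics: `B / 6 < 1/24 ≤ -e⋆`
  have hBsmall : B < 1 / 4 := by
    have h1 : (δ * R)⁻¹ < 10⁻¹ := (inv_lt_inv₀ (by positivity) (by norm_num)).2 hR
    have h2 : (δ * R)⁻¹ ^ 3 < (10 : ℝ)⁻¹ ^ 3 := pow_lt_pow_left₀ h1 (inv_nonneg.2 (by positivity)) (by norm_num)
    have h3 : δ⁻¹ ^ 3 * R⁻¹ ^ 3 = (δ * R)⁻¹ ^ 3 := by rw [mul_inv, mul_pow]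
    rw [hB, mul_assoc, h3]
    norm_num at h2 ⊢
    linarith
  have he : eStar ≤ -1 / 24 := by
    have h1 : eStar ≤ groundStateEnergy lennardJones 3 2 / 2 := by
      simpa using eStar_le_groundStateEnergy_div (N := 2) two_pos
    have h2 : groundStateEnergy lennardJones 3 2 ≤ -1 / 12 := by
      have := groundStateEnergy_lennardJones_le (d := 3) dimer_injective
      rwa [interactionEnergy_dimer] at this
    linarith
  -- facts about hard-core configurations: kept set, isolation
  have hK : ∀ μ : Measure E3, {u : E3 | μ.map (fun x : E3 => x - u) ∈ G} = {u : E3 | 1 < μ (closedBall u R)} := fun μ => by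
    ext u; exact map_sub_mem_crowded_iff μ R u
  obtain ⟨T, hTm, hT⟩ := exists_measurable_thinning (G := G) hδ hG
  -- (1) thinning stability
  have hts := thinning_stability hU hδ hcore hstat hG
  -- integrability of `h ∘ T` on `G`
  set Q : Measure (Measure E3) := (P.restrict G).map T with hQ
  haveI : IsFiniteMeasure Q := ⟨by
    rw [hQ, Measure.map_apply hTm MeasurableSet.univ, Set.preimage_univ, Measure.restrict_apply_univ]; exact measure_lt_top P G⟩
  have hcoreQ : ∀ᵐ ν ∂Q, IsRootedHardCore δ ν := ae_isRootedHardCore_thinned hδ hcore hG hTm hT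
  have hintQ : Integrable (fun ν => rootEnergy lennardJones ν) Q := integrable_rootEnergy_of_ae_hardCore hδ hcoreQ
  have hintT : Integrable (fun μ => rootEnergy lennardJones (μ.restrict {u : E3 | μ.map (fun x : E3 => x - u) ∈ G})) (P.restrict G) := by
    have h1 : Integrable (fun μ => rootEnergy lennardJones (T μ)) (P.restrict G) :=
      (integrable_map_measure hintQ.aestronglyMeasurable hTm.aemeasurable).1 hintQ
    exact h1.congr ((ae_restrict_of_ae (s := G) hcore).mono fun μ hμ => by
      show rootEnergy lennardJones (T μ) = _
      rw [(hT μ hμ).2])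
  have hintP : Integrable (fun μ : Measure E3 => rootEnergy lennardJones μ) P := integrable_rootEnergy_of_ae_hardCore hδ hcore
  -- the deleted-atoms functional, its measurable version and bounds
  obtain ⟨κ, hκs, hκ⟩ := exists_kernel_eq_count_restrict hδ
  have hκid : ∀ μ : Measure E3, IsRootedHardCore δ μ → κ μ = μ := by
    rintro μ ⟨S, -, hsep, rfl⟩; exact hκ S hsep
  set A : Set (Measure E3 × E3) := (fun q : Measure E3 × E3 => (κ q.1).map fun z => z - q.2) ⁻¹' G with hAdef
  have hA : MeasurableSet A := measurable_kernel_map_sub κ hG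
  have hsec : ∀ μ : Measure E3, IsRootedHardCore δ μ → ∀ y : E3,
      ((μ, y) ∈ A ↔ y ∈ {u : E3 | μ.map (fun x : E3 => x - u) ∈ G}) := fun μ hμ y => by
    simp only [hAdef, Set.mem_preimage, Set.mem_setOf_eq, hκid μ hμ]
  set Dκ : Measure E3 → ℝ≥0∞ := fun μ => ∫⁻ y, Aᶜ.indicator (fun _ => (1 : ℝ≥0∞)) (μ, y) * ENNReal.ofReal (‖y‖⁻¹ ^ 6) ∂(κ μ) with hDκ
  have hDκm : Measurable Dκ :=
    Measurable.lintegral_kernel_prod_right ((measurable_const.indicator hA.compl).mul ((measurable_ofReal_invPow 6).comp measurable_snd))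
  have hDκeq : ∀ μ : Measure E3, IsRootedHardCore δ μ →
      Dκ μ = ∫⁻ y in {u : E3 | μ.map (fun x : E3 => x - u) ∈ G}ᶜ, ENNReal.ofReal (‖y‖⁻¹ ^ 6) ∂μ := by
    intro μ hμ
    simp only [hDκ, hκid μ hμ]
    rw [← lintegral_indicator (hT μ hμ).1.compl]
    refine lintegral_congr fun y => ?_
    by_cases hy : y ∈ {u : E3 | μ.map (fun x : E3 => x - u) ∈ G}
    · rw [Set.indicator_of_notMem (fun h => Set.notMem_of_mem_compl h ((hsec μ hμ y).2 hy)),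
        Set.indicator_of_notMem (fun h => Set.notMem_of_mem_compl h hy), zero_mul]
    · rw [Set.indicator_of_mem (show (μ, y) ∈ Aᶜ from fun h => hy ((hsec μ hμ y).1 h)),
        Set.indicator_of_mem (show y ∈ {u : E3 | μ.map (fun x : E3 => x - u) ∈ G}ᶜ from hy), one_mul]
  have hDle : ∀ μ : Measure E3, IsRootedHardCore δ μ → Dκ μ ≤ ENNReal.ofReal (250 * δ⁻¹ ^ 6) := fun μ hμ => by
    rw [hDκeq μ hμ]
    exact (setLIntegral_le_lintegral _ _).trans (lintegral_invPow_le_of_isRootedHardCore hδ hμ).1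
  have hDint : Integrable (fun μ => (Dκ μ).toReal) P :=
    Integrable.of_bound hDκm.ennreal_toReal.aestronglyMeasurable (ENNReal.ofReal (250 * δ⁻¹ ^ 6)).toReal
      (hcore.mono fun μ hμ => by
        rw [Real.norm_eq_abs, abs_of_nonneg ENNReal.toReal_nonneg]
        exact ENNReal.toReal_mono ENNReal.ofReal_ne_top (hDle μ hμ))
  -- (2) pointwise on `G`: `h(T μ) ≤ h(μ) + (1/12) D(μ)`
  have hstep : ∫ μ in G, rootEnergy lennardJones (μ.restrict {u : E3 | μ.map (fun x : E3 => x - u) ∈ G}) ∂P ≤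
      ∫ μ in G, (rootEnergy lennardJones μ + 1 / 12 * (Dκ μ).toReal) ∂P := by
    refine integral_mono_ae hintT (hintP.integrableOn.add ((hDint.const_mul _).integrableOn)) ?_
    filter_upwards [ae_restrict_of_ae (s := G) hcore] with μ hμ
    rw [hDκeq μ hμ]
    exact rootEnergy_restrict_le hδ hμ (hT μ hμ).1
  -- (3) the deleted-atoms term by mass transport and the two-scale bound at isolated roots
  have hfar : ∀ᵐ μ ∂P, μ ∈ Gᶜ → ∫⁻ y, ENNReal.ofReal (‖y‖⁻¹ ^ 6) ∂μ ≤ ENNReal.ofReal B := by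
    filter_upwards [hcore] with μ hμ hμG
    obtain ⟨S, h0S, hsep, rfl⟩ := hμ
    refine lintegral_invPow_six_le_two_scale hδ hδR h0S hsep fun y hy hy0 => ?_
    have hiso : ¬ 1 < (Measure.count : Measure E3).restrict S (closedBall (0 : E3) R) := hμG
    have h := lt_dist_of_isolated h0S hiso hy hy0
    rw [dist_zero_right] at h
    exact h.le
  have hMT : ∫⁻ μ in G, Dκ μ ∂P ≤ ENNReal.ofReal B * P Gᶜ := by
    calc ∫⁻ μ in G, Dκ μ ∂P
        = ∫⁻ μ in G, (∫⁻ y in {u : E3 | μ.map (fun x : E3 => x - u) ∈ G}ᶜ, ENNReal.ofReal (‖y‖⁻¹ ^ 6) ∂μ) ∂P :=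
          lintegral_congr_ae ((ae_restrict_iff' hG).2 (hcore.mono fun μ hμ _ => hDκeq μ hμ))
      _ ≤ ∫⁻ μ in Gᶜ, (∫⁻ y, ENNReal.ofReal (‖y‖⁻¹ ^ 6) ∂μ) ∂P := lintegral_deleted_le hδ hcore hstat hG
      _ ≤ ∫⁻ _ in Gᶜ, ENNReal.ofReal B ∂P := lintegral_mono_ae ((ae_restrict_iff' hG.compl).2 hfar)
      _ = ENNReal.ofReal B * P Gᶜ := setLIntegral_const _ _
  -- (4) everything in real numbers
  set p : ℝ := (P Gᶜ).toReal with hpdef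
  have hp0 : 0 < p := ENNReal.toReal_pos hp (measure_ne_top P Gᶜ)
  have hPG : (P G).toReal = 1 - p := by
    have h : (P G).toReal + (P Gᶜ).toReal = 1 := by
      rw [← ENNReal.toReal_add (measure_ne_top P G) (measure_ne_top P Gᶜ), measure_add_measure_compl hG, measure_univ,
        ENNReal.toReal_one]
    linarith
  have hDreal : ∫ μ in G, (Dκ μ).toReal ∂P ≤ B * p := by
    rw [integral_toReal hDκm.aemeasurable ((ae_restrict_of_ae (s := G) hcore).mono fun μ hμ =>
      (hDle μ hμ).trans_lt ENNReal.ofReal_lt_top)]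
    have h := ENNReal.toReal_mono (ENNReal.mul_ne_top ENNReal.ofReal_ne_top (measure_ne_top P Gᶜ)) hMT
    rwa [ENNReal.toReal_mul, ENNReal.toReal_ofReal hB0] at h
  have hsplit : ∫ μ in G, (rootEnergy lennardJones μ + 1 / 12 * (Dκ μ).toReal) ∂P =
      ∫ μ in G, rootEnergy lennardJones μ ∂P + 1 / 12 * ∫ μ in G, (Dκ μ).toReal ∂P := by
    rw [integral_add hintP.integrableOn ((hDint.const_mul _).integrableOn), integral_const_mul]
  have hcompl : ∫ μ in G, rootEnergy lennardJones μ ∂P + ∫ μ in Gᶜ, rootEnergy lennardJones μ ∂P =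
      ∫ μ, rootEnergy lennardJones μ ∂P := integral_add_compl hG hintP
  -- (5) the deleted roots' energy is `≥ -(B/12)` each
  have hiso : -(1 / 12 * B) * p ≤ ∫ μ in Gᶜ, rootEnergy lennardJones μ ∂P := by
    have hc : ∫ _ in Gᶜ, -(1 / 12 * B) ∂P = -(1 / 12 * B) * p := by
      rw [setIntegral_const, smul_eq_mul, mul_comm]
      rfl
    rw [← hc]
    refine integral_mono_ae (integrable_const _) hintP.integrableOn ?_
    refine (ae_restrict_iff' hG.compl).2 ?_
    filter_upwards [hcore, hfar] with μ hμ hμfar hμG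
    have h1 := neg_moment_le_rootEnergy hδ hμ
    have h2 : (∫⁻ y, ENNReal.ofReal (‖y‖⁻¹ ^ 6) ∂μ).toReal ≤ B := by
      rw [← ENNReal.toReal_ofReal hB0]
      exact ENNReal.toReal_mono ENNReal.ofReal_ne_top (hμfar hμG)
    linarith
  -- (6) combine
  rw [hPG] at hts
  have hchain : (1 - p) * eStar ≤ eStar + 1 / 12 * (B * p) + 1 / 12 * B * p := by
    have h1 := hts.trans hstep
    rw [hsplit] at h1
    linarith
  have hkey : p * (-eStar - B / 6) ≤ 0 := by linarith
  have hpos : 0 < -eStar - B / 6 := by linarith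
  linarith [mul_pos hp0 hpos]

/-- **NO RATTLERS, EVERY ATOM.**  Under the hypotheses of `ae_crowded_of_minimising`, almost surely EVERY atom `y` of the configuration has
another atom within distance `R`: `1 < μ(B̄(y, R))` (Aldous–Lyons transfer `IsPointStationaryLaw.ae_forall_map_sub`). [folklore] -/
theorem ae_forall_crowded_of_minimising
    (hU : ∀ δ' : ℝ, 0 < δ' → ∀ Q : Measure (Measure E3), IsProbabilityMeasure Q → (∀ᵐ μ ∂Q, IsRootedHardCore δ' μ) →
      IsPointStationaryLaw Q → eStar ≤ ∫ μ, rootEnergy lennardJones μ ∂Q)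
    (hδ : 0 < δ) [IsProbabilityMeasure P] (hcore : ∀ᵐ μ ∂P, IsRootedHardCore δ μ) (hstat : IsPointStationaryLaw P)
    (hmin : ∫ μ, rootEnergy lennardJones μ ∂P ≤ eStar) (hδR : δ ≤ R) (hR : 10 < δ * R) :
    ∀ᵐ μ ∂P, ∀ y : E3, μ {y} ≠ 0 → 1 < μ (closedBall y R) := by
  -- local finiteness on the norm shells (hard core)
  have hlf : ∀ᵐ μ ∂P, ∀ n : ℕ, μ ((fun z : E3 => ⌊‖z‖⌋₊) ⁻¹' {n}) < ∞ := by
    filter_upwards [hcore] with μ hμ n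
    obtain ⟨S, h0, hsep, rfl⟩ := hμ
    have hsub : (fun z : E3 => ⌊‖z‖⌋₊) ⁻¹' {n} ∩ S ⊆ closedBall (0 : E3) (n + 1) ∩ S := by
      rintro z ⟨hz, hzS⟩
      refine ⟨mem_closedBall.2 ?_, hzS⟩
      rw [dist_zero_right]
      have h1 : (⌊‖z‖⌋₊ : ℝ) = n := by exact_mod_cast hz
      have h2 := Nat.lt_floor_add_one ‖z‖
      rw [h1] at h2
      exact h2.le
    have hfin : ((fun z : E3 => ⌊‖z‖⌋₊) ⁻¹' {n} ∩ S).Finite :=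
      (finite_inter_of_separated hδ hsep (isCompact_closedBall (0 : E3) (n + 1))).subset hsub
    have hmeas : Measurable (fun z : E3 => ⌊‖z‖⌋₊) := Nat.measurable_floor.comp measurable_norm
    rw [Measure.restrict_apply (hmeas (measurableSet_singleton n))]
    exact Measure.count_apply_lt_top.2 hfin
  have h := hstat.ae_forall_map_sub hlf (ae_crowded_of_minimising hU hδ hcore hstat hmin hδR hR)
  filter_upwards [h] with μ hμ y hy
  have h1 := hμ y hy
  rwa [← map_sub_mem_crowded_iff μ R y]

end NoRattlers

end Summit.AtomisticToContinuum.Crystallization.Theorems.FrustratedLawDichotomyThinning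

end
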